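import Literature.Analysis.PDE.CoordWordTame
import Mathlib.MeasureTheory.Function.Jacobian
import Mathlib.Data.Set.Finite.List
import Mathlib.MeasureTheory.Function.L2Space
import Mathlib.Analysis.Normed.Module.FiniteDimension
import HarnessLib

/-!
# Transfer operators `u ↦ m · (u ∘ τ)`: smoothness, chain-rule structure, `L²` bounds by change
# of variables

Analytic layer of the energy-method programme for short-time existence of quasilinear strictly
parabolic second-order systems on a closed manifold (hypothesis `hQL` of
`Literature.Geometry.Riemannian.ricciFlow_shortTime_existence_of_quasilinear`). Reconstructing a
map on the manifold from its localisations, and re-reading it in another chart, produces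
operators of the form `(T u)(x) = m(x) u(τ x)` on maps `ℝⁿ → F`, where `τ` is a chart transition
— a local diffeomorphism, smooth on an open set `Ω` — and `m` a smooth cut-off with
`tsupport m ⊆ Ω` compact. This file proves what the Gårding estimate and the Galerkin operator
need about them (Adams, *Sobolev Spaces*, Thm. 3.35: `W^{m,p}` is stable under smooth changes of
coordinates, proof by the chain rule and the change of variables formula):

* `transfer m τ u` and its smoothness for smooth `u` (`contDiff_transfer`: on `Ω` a product of
  smooth maps, near the complement of `tsupport m` identically zero), support
  (`tsupport_transfer_subset`);
* `tterms m τ v` — the list of (coefficient, word) pairs of the **chain-rule structure**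
  `∂_v (m · u ∘ τ)(x) = Σ_{(c, w)} c(x) · (∂_w u)(τ x)` (`cwd_transfer`), all coefficients smooth,
  supported in `tsupport m`, all words of length `≤ |v|` (`tterms_spec`);
* `integral_sq_comp_le` — **change of variables**: `∫_K ‖h(τ x)‖² dx ≤ δ⁻¹ ∫ ‖h‖²` when
  `|det Dτ| ≥ δ > 0` on the compact `K ⊆ Ω` and `τ` is injective on `Ω` (Mathlib's
  `integral_image_eq_integral_abs_det_fderiv_smul`);
* `exists_l2_cwd_transfer_le` — **the `L²` bound**: `‖∂_v (m · u ∘ τ)‖_{L²} ≤ C max_{|w| ≤ |v|} ‖∂_w u‖_{L²}`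
  for smooth compactly supported `u`, `C` depending only on `m, τ` and the order;
* `exists_sup_cwd_transfer_le` — the corresponding sup bound.

Everything is proved; no named fact and no `sorry` is introduced.

## References

* R. A. Adams, *Sobolev Spaces*, Academic Press 1975, Thm. 3.35 (coordinate transformations on
  `W^{m,p}`). [Adams1975]
* L. C. Evans, *Partial Differential Equations*, 2nd ed., AMS 2010, App. C.4 (change of
  variables) and §5.2.3. [Evans2010]
-/

noncomputable section

open MeasureTheory Set Function Filter
open scoped ContDiff Topology ENNReal

namespace Literature.Analysis.PDE

open Literature.Analysis.FunctionSpaces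

variable {ι : Type*} [Fintype ι] [DecidableEq ι]
variable {F : Type*} [NormedAddCommGroup F] [NormedSpace ℝ F]

/-! ### Smooth functions supported inside an open set times functions smooth on that set -/

omit [DecidableEq ι] in
/-- A function that vanishes on a neighbourhood of `x` has all word derivatives vanishing at `x`.
[folklore] -/
theorem cwd_eq_zero_of_eventuallyEq_zero {f : EuclideanSpace ℝ ι → F} {x : EuclideanSpace ℝ ι}
    (h : f =ᶠ[𝓝 x] 0) (v : List ι) : cwd v f x = 0 := by
  have h1 := (eventuallyEq_cwd h v).eq_of_nhds
  rw [h1]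
  simp

omit [Fintype ι] [DecidableEq ι] in
/-- Outside the topological support a function vanishes near the point. [folklore] -/
theorem eventuallyEq_zero_of_notMem_tsupport {G : Type*} [Zero G] {f : EuclideanSpace ℝ ι → G}
    {x : EuclideanSpace ℝ ι} (hx : x ∉ tsupport f) : f =ᶠ[𝓝 x] 0 := by
  have hopen : IsOpen (tsupport f)ᶜ := (isClosed_tsupport f).isOpen_compl
  filter_upwards [hopen.mem_nhds hx] with y hy
  exact image_eq_zero_of_notMem_tsupport hy

omit [DecidableEq ι] in
/-- **Gluing smoothness**: a function smooth on an open set `Ω` containing its topological support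
is smooth everywhere. [folklore] -/
theorem contDiff_of_contDiffOn_of_tsupport_subset {G : Type*} [NormedAddCommGroup G]
    [NormedSpace ℝ G] {f : EuclideanSpace ℝ ι → G} {Ω : Set (EuclideanSpace ℝ ι)} (hΩ : IsOpen Ω)
    {r : WithTop ℕ∞} (hf : ContDiffOn ℝ r f Ω) (hsupp : tsupport f ⊆ Ω) : ContDiff ℝ r f := by
  rw [contDiff_iff_contDiffAt]
  intro x
  by_cases hx : x ∈ Ω
  · exact hf.contDiffAt (hΩ.mem_nhds hx)
  · have h0 : f =ᶠ[𝓝 x] fun _ => 0 := eventuallyEq_zero_of_notMem_tsupport fun h => hx (hsupp h)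
    exact (contDiffAt_const (c := (0 : G))).congr_of_eventuallyEq h0

omit [DecidableEq ι] in
/-- **Products with a smooth cut-off supported inside `Ω`**: if `c` is smooth with
`tsupport c ⊆ Ω` and `g` is smooth on the open set `Ω`, then `x ↦ c x • g x` is smooth (everywhere)
with topological support inside `tsupport c`. [folklore] -/
theorem contDiff_cutoff_smul {G : Type*} [NormedAddCommGroup G] [NormedSpace ℝ G]
    {c : EuclideanSpace ℝ ι → ℝ} {g : EuclideanSpace ℝ ι → G} {Ω : Set (EuclideanSpace ℝ ι)}
    (hΩ : IsOpen Ω) {r : WithTop ℕ∞} (hc : ContDiff ℝ r c) (hcΩ : tsupport c ⊆ Ω)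
    (hg : ContDiffOn ℝ r g Ω) :
    ContDiff ℝ r (fun x => c x • g x) ∧ tsupport (fun x => c x • g x) ⊆ tsupport c := by
  have hsupp : tsupport (fun x => c x • g x) ⊆ tsupport c :=
    closure_mono fun x hx => by
      rw [mem_support] at hx ⊢
      intro h0; exact hx (by rw [h0, zero_smul])
  refine ⟨contDiff_of_contDiffOn_of_tsupport_subset hΩ (hc.contDiffOn.smul hg)
    (hsupp.trans hcΩ), hsupp⟩

/-! ### The transfer operator -/

/-- **The transfer operator** `transfer m τ u = m · (u ∘ τ)`. [folklore] -/
def transfer (m : EuclideanSpace ℝ ι → ℝ) (τ : EuclideanSpace ℝ ι → EuclideanSpace ℝ ι)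
    (u : EuclideanSpace ℝ ι → F) : EuclideanSpace ℝ ι → F :=
  fun x => m x • u (τ x)

omit [Fintype ι] [DecidableEq ι] in
/-- Unfolding. [folklore] -/
@[simp]
theorem transfer_apply (m : EuclideanSpace ℝ ι → ℝ) (τ : EuclideanSpace ℝ ι → EuclideanSpace ℝ ι)
    (u : EuclideanSpace ℝ ι → F) (x : EuclideanSpace ℝ ι) : transfer m τ u x = m x • u (τ x) := rfl

/-- **Transfer data**: an open set `Ω`, a map `τ` smooth and injective on `Ω` with invertible
derivative there (a diffeomorphism onto its open image, e.g. a chart transition), and a smooth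
cut-off `m` with compact topological support inside `Ω`. [folklore] -/
structure TransferData (ι : Type*) [Fintype ι] where
  /-- the open set on which the transition map is smooth -/
  Ω : Set (EuclideanSpace ℝ ι)
  /-- the transition map (total; only its values on `Ω` matter) -/
  τ : EuclideanSpace ℝ ι → EuclideanSpace ℝ ι
  /-- the multiplier -/
  m : EuclideanSpace ℝ ι → ℝ
  isOpen_Ω : IsOpen Ω
  contDiffOn_τ : ContDiffOn ℝ ∞ τ Ω
  injOn_τ : InjOn τ Ω
  det_ne_zero : ∀ x ∈ Ω, (fderiv ℝ τ x).det ≠ 0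
  contDiff_m : ContDiff ℝ ∞ m
  hasCompactSupport_m : HasCompactSupport m
  tsupport_m_subset : tsupport m ⊆ Ω

namespace TransferData

variable (D : TransferData ι)

omit [DecidableEq ι] in
/-- **Smoothness of the transfer of a smooth map**. [cite: Adams1975, Thm. 3.35] -/
theorem contDiff_transfer {u : EuclideanSpace ℝ ι → F} (hu : ContDiff ℝ ∞ u) :
    ContDiff ℝ ∞ (transfer D.m D.τ u) :=
  (contDiff_cutoff_smul D.isOpen_Ω D.contDiff_m D.tsupport_m_subset
    (hu.comp_contDiffOn D.contDiffOn_τ)).1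

omit [DecidableEq ι] in
/-- **Finite differentiability of the transfer of a `C^r` map** (`r` finite or not).
[cite: Adams1975, Thm. 3.35] -/
theorem contDiff_transfer_of_le {u : EuclideanSpace ℝ ι → F} {r : WithTop ℕ∞} (hr : r ≤ (∞ : WithTop ℕ∞))
    (hu : ContDiff ℝ r u) : ContDiff ℝ r (transfer D.m D.τ u) :=
  (contDiff_cutoff_smul D.isOpen_Ω (D.contDiff_m.of_le hr) D.tsupport_m_subset
    (hu.comp_contDiffOn (D.contDiffOn_τ.of_le hr))).1

omit [DecidableEq ι] in
/-- The transfer is supported in `tsupport m`. [folklore] -/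
theorem tsupport_transfer_subset (u : EuclideanSpace ℝ ι → F) :
    tsupport (transfer D.m D.τ u) ⊆ tsupport D.m :=
  closure_mono fun x hx => by
    rw [mem_support] at hx ⊢
    intro h0; exact hx (by simp [transfer, h0])

omit [DecidableEq ι] in
/-- The transfer has compact support. [folklore] -/
theorem hasCompactSupport_transfer (u : EuclideanSpace ℝ ι → F) :
    HasCompactSupport (transfer D.m D.τ u) :=
  D.hasCompactSupport_m.of_isClosed_subset (isClosed_tsupport _) (D.tsupport_transfer_subset u)

omit [DecidableEq ι] in
/-- The transfer is additive. [folklore] -/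
theorem transfer_add (u u' : EuclideanSpace ℝ ι → F) :
    transfer D.m D.τ (u + u') = transfer D.m D.τ u + transfer D.m D.τ u' := by
  funext x; simp [transfer, smul_add]

omit [DecidableEq ι] in
/-- The transfer is homogeneous. [folklore] -/
theorem transfer_smul (c : ℝ) (u : EuclideanSpace ℝ ι → F) :
    transfer D.m D.τ (c • u) = c • transfer D.m D.τ u := by
  funext x; simp [transfer, smul_comm (D.m x) c]

/-! ### The chain-rule structure -/

/-- One differentiation step on a (coefficient, word) pair: `∂_i (c · ∂_w u ∘ τ)` is
`(∂_i c) · ∂_w u ∘ τ + Σ_l (c · ∂_i τ_l) · ∂_{l w} u ∘ τ`. [folklore] -/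
def tstep (i : ι) (p : (EuclideanSpace ℝ ι → ℝ) × List ι) : List ((EuclideanSpace ℝ ι → ℝ) × List ι) :=
  (fun x => fderiv ℝ p.1 x (bv i), p.2) ::
    (Finset.univ : Finset ι).toList.map fun l =>
      (fun x => p.1 x * (fderiv ℝ D.τ x (bv i)) l, l :: p.2)

/-- **The chain-rule terms** of `∂_v (m · u ∘ τ)`: a list of (coefficient, word) pairs.
[cite: Adams1975, Thm. 3.35] -/
def tterms : List ι → List ((EuclideanSpace ℝ ι → ℝ) × List ι)
  | [] => [(D.m, [])]
  | i :: v => (tterms v).flatMap (D.tstep i)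

omit [DecidableEq ι] in
/-- **Specification of the chain-rule terms**: every coefficient is smooth with topological
support inside `tsupport m`, and every word has length at most `|v|`. [folklore] -/
theorem tterms_spec (v : List ι) :
    ∀ p ∈ D.tterms v, ContDiff ℝ ∞ p.1 ∧ tsupport p.1 ⊆ tsupport D.m ∧ p.2.length ≤ v.length := by
  induction v with
  | nil =>
    intro p hp
    simp only [tterms, List.mem_singleton] at hp
    subst hp
    exact ⟨D.contDiff_m, Subset.rfl, le_rfl⟩
  | cons i v ih =>
    intro p hp
    simp only [tterms, List.mem_flatMap] at hp
    obtain ⟨q, hq, hpq⟩ := hp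
    obtain ⟨hq1, hq2, hq3⟩ := ih q hq
    simp only [tstep, List.mem_cons, List.mem_map, Finset.mem_toList, Finset.mem_univ,
      true_and] at hpq
    rcases hpq with rfl | ⟨l, rfl⟩
    · refine ⟨(hq1.fderiv_right (m := ∞) (by norm_cast)).clm_apply contDiff_const, ?_,
        hq3.trans (Nat.le_succ _)⟩
      exact (tsupport_fderiv_apply_subset ℝ (bv i)).trans hq2
    · have hτl : ContDiffOn ℝ ∞ (fun x => (fderiv ℝ D.τ x (bv i)) l) D.Ω := by
        have h1 : ContDiffOn ℝ ∞ (fun x => fderiv ℝ D.τ x (bv i)) D.Ω :=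
          (D.contDiffOn_τ.fderiv_of_isOpen D.isOpen_Ω (by norm_cast)).clm_apply contDiffOn_const
        exact (EuclideanSpace.proj (𝕜 := ℝ) l).contDiff.comp_contDiffOn h1
      have h := contDiff_cutoff_smul (G := ℝ) D.isOpen_Ω hq1
        (hq2.trans D.tsupport_m_subset) hτl
      simp only [smul_eq_mul] at h
      exact ⟨h.1, h.2.trans hq2, by simp; omega⟩

omit [DecidableEq ι] in
/-- Coefficients vanish, together with a neighbourhood, off `tsupport m`. [folklore] -/
theorem coef_eventuallyEq_zero {v : List ι} {p : (EuclideanSpace ℝ ι → ℝ) × List ι}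
    (hp : p ∈ D.tterms v) {x : EuclideanSpace ℝ ι} (hx : x ∉ tsupport D.m) : p.1 =ᶠ[𝓝 x] 0 :=
  eventuallyEq_zero_of_notMem_tsupport fun h => hx ((D.tterms_spec v p hp).2.1 h)

omit [DecidableEq ι] in
/-- Summation over `tstep`. [folklore] -/
theorem sum_map_tstep {M : Type*} [AddCommMonoid M] (i : ι) (p : (EuclideanSpace ℝ ι → ℝ) × List ι)
    (Φ : (EuclideanSpace ℝ ι → ℝ) × List ι → M) :
    ((D.tstep i p).map Φ).sum = Φ (fun x => fderiv ℝ p.1 x (bv i), p.2) +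
      ∑ l : ι, Φ (fun x => p.1 x * (fderiv ℝ D.τ x (bv i)) l, l :: p.2) := by
  rw [tstep, List.map_cons, List.sum_cons, List.map_map]
  congr 1
  exact Finset.sum_map_toList (Finset.univ : Finset ι)
    fun l => Φ (fun x => p.1 x * (fderiv ℝ D.τ x (bv i)) l, l :: p.2)

omit [Fintype ι] [DecidableEq ι] in
/-- Summation over a `flatMap`. [folklore] -/
theorem _root_.Literature.Analysis.PDE.sum_map_flatMap {α β M : Type*} [AddCommMonoid M] (l : List α) (g : α → List β)
    (Φ : β → M) : ((l.flatMap g).map Φ).sum = (l.map fun a => ((g a).map Φ).sum).sum := by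
  induction l with
  | nil => rfl
  | cons a l ih => simp [List.flatMap_cons, ih]

omit [DecidableEq ι] in
/-- **The chain rule for one (coefficient, word) pair inside `Ω`**: for `x ∈ Ω`,
`∂_i (c · ∂_w u ∘ τ)(x) = Σ_{tstep} …`. [folklore] -/
theorem fderiv_coef_smul_cwd_comp {u : EuclideanSpace ℝ ι → F} (hu : ContDiff ℝ ∞ u)
    {c : EuclideanSpace ℝ ι → ℝ} (hc : ContDiff ℝ ∞ c) (w : List ι) {x : EuclideanSpace ℝ ι}
    (hx : x ∈ D.Ω) (i : ι) :
    fderiv ℝ (fun y => c y • cwd w u (D.τ y)) x (bv i) =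
      fderiv ℝ c x (bv i) • cwd w u (D.τ x) +
        ∑ l : ι, (c x * (fderiv ℝ D.τ x (bv i)) l) • cwd (l :: w) u (D.τ x) := by
  classical
  have hτ : DifferentiableAt ℝ D.τ x :=
    (D.contDiffOn_τ.differentiableOn (by simp)).differentiableAt (D.isOpen_Ω.mem_nhds hx)
  have hcw : DifferentiableAt ℝ (cwd w u) (D.τ x) := differentiable_cwd hu w _
  have hcomp : DifferentiableAt ℝ (fun y => cwd w u (D.τ y)) x := hcw.comp x hτ
  have hc' : DifferentiableAt ℝ c x := (hc.differentiable (by simp)) x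
  rw [fderiv_fun_smul hc' hcomp]
  simp only [add_apply, smul_apply, ContinuousLinearMap.smulRight_apply, add_comm]
  congr 1
  -- the chain rule for `cwd w u ∘ τ`, expanded in the frame
  have hchain : fderiv ℝ (fun y => cwd w u (D.τ y)) x (bv i) =
      fderiv ℝ (cwd w u) (D.τ x) (fderiv ℝ D.τ x (bv i)) := by
    rw [show (fun y => cwd w u (D.τ y)) = cwd w u ∘ D.τ from rfl, fderiv_comp x hcw hτ]
    rfl
  rw [hchain]
  set e : EuclideanSpace ℝ ι := fderiv ℝ D.τ x (bv i) with he
  have he' : e = ∑ l, e l • (bv l : EuclideanSpace ℝ ι) := by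
    simpa [bv_def] using ((EuclideanSpace.basisFun ι ℝ).sum_repr e).symm
  conv_lhs => rw [he']
  rw [map_sum, Finset.smul_sum]
  refine Finset.sum_congr rfl fun l _ => ?_
  rw [map_smul, cwd_cons, smul_smul]

omit [DecidableEq ι] in
/-- **The chain-rule structure of the transfer**: for smooth `u` and every word `v`,
`∂_v (m · u ∘ τ)(x) = Σ_{(c, w) ∈ tterms v} c(x) · (∂_w u)(τ x)` at every `x`.
[cite: Adams1975, Thm. 3.35] -/
theorem cwd_transfer {u : EuclideanSpace ℝ ι → F} (hu : ContDiff ℝ ∞ u) (v : List ι) :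
    cwd v (transfer D.m D.τ u) =
      fun x => ((D.tterms v).map fun p => p.1 x • cwd p.2 u (D.τ x)).sum := by
  induction v with
  | nil => funext x; simp [tterms, transfer]
  | cons i v ih =>
    funext x
    rw [cwd_cons]
    change fderiv ℝ (cwd v (transfer D.m D.τ u)) x (bv i) = _
    rw [ih]
    simp only [tterms]
    rw [sum_map_flatMap]
    -- differentiability of each term everywhere (the terms are smooth)
    have hterm : ∀ p ∈ D.tterms v, ContDiff ℝ ∞ (fun y => p.1 y • cwd p.2 u (D.τ y)) := by
      intro p hp
      obtain ⟨hp1, hp2, _⟩ := D.tterms_spec v p hp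
      exact (contDiff_cutoff_smul D.isOpen_Ω hp1 (hp2.trans D.tsupport_m_subset)
        ((contDiff_cwd hu p.2).comp_contDiffOn D.contDiffOn_τ)).1
    have hdiff : ∀ p ∈ D.tterms v, Differentiable ℝ (fun y => p.1 y • cwd p.2 u (D.τ y)) :=
      fun p hp => (hterm p hp).differentiable (by simp)
    rw [fderiv_list_sum_map_apply (D.tterms v) hdiff x (bv i)]
    congr 1
    refine List.map_congr_left fun p hp => ?_
    rw [D.sum_map_tstep]
    obtain ⟨hp1, _, _⟩ := D.tterms_spec v p hp
    by_cases hx : x ∈ D.Ω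
    · exact D.fderiv_coef_smul_cwd_comp hu hp1 p.2 hx i
    · -- off `Ω ⊇ tsupport m`: everything vanishes near `x`
      have hxm : x ∉ tsupport D.m := fun h => hx (D.tsupport_m_subset h)
      have hp0 : p.1 =ᶠ[𝓝 x] 0 := D.coef_eventuallyEq_zero hp hxm
      have hterm0 : (fun y => p.1 y • cwd p.2 u (D.τ y)) =ᶠ[𝓝 x] fun _ => 0 := by
        filter_upwards [hp0] with y hy
        simp [hy]
      rw [hterm0.fderiv_eq, show fderiv ℝ (fun _ : EuclideanSpace ℝ ι => (0 : F)) x = 0 from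
        fderiv_const_apply 0]
      have h1 : fderiv ℝ p.1 x (bv i) = 0 := by
        rw [hp0.fderiv_eq, show fderiv ℝ (0 : EuclideanSpace ℝ ι → ℝ) x = 0 from
          congrFun fderiv_zero x]
        rfl
      have h2 : p.1 x = 0 := hp0.eq_of_nhds
      simp [h1, h2]

omit [DecidableEq ι] in
/-- **Pointwise bound for the transfer**: `‖∂_v (m · u ∘ τ)(x)‖ ≤ Σ_{(c,w)} |c x| ‖∂_w u (τ x)‖`.
[folklore] -/
theorem norm_cwd_transfer_le {u : EuclideanSpace ℝ ι → F} (hu : ContDiff ℝ ∞ u) (v : List ι)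
    (x : EuclideanSpace ℝ ι) :
    ‖cwd v (transfer D.m D.τ u) x‖ ≤
      ((D.tterms v).map fun p => |p.1 x| * ‖cwd p.2 u (D.τ x)‖).sum := by
  rw [D.cwd_transfer hu v]
  refine (norm_list_sum_le _).trans ?_
  rw [List.map_map]
  refine List.sum_le_sum fun p _ => ?_
  simp [norm_smul]

omit [Fintype ι] [DecidableEq ι] in
/-- A member of a list of reals with nonnegative entries is at most the sum. [folklore] -/
theorem le_sum_of_mem_of_nonneg {l : List ℝ} (hl : ∀ y ∈ l, 0 ≤ y) {x : ℝ} (hx : x ∈ l) :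
    x ≤ l.sum := by
  induction l with
  | nil => exact absurd hx List.not_mem_nil
  | cons a l ih =>
    rw [List.sum_cons]
    have hl' : ∀ y ∈ l, 0 ≤ y := fun y hy => hl y (List.mem_cons_of_mem _ hy)
    have hs : 0 ≤ l.sum := List.sum_nonneg hl'
    rcases List.mem_cons.1 hx with rfl | hx'
    · linarith
    · have := ih hl' hx'
      linarith [hl a List.mem_cons_self]

omit [DecidableEq ι] in
/-- All coefficients of the chain-rule terms of words of bounded length are uniformly bounded.
[folklore] -/
theorem exists_coef_bound (n : ℕ) :
    ∃ M : ℝ, 0 ≤ M ∧ ∀ v : List ι, v.length ≤ n → ∀ p ∈ D.tterms v, ∀ x, |p.1 x| ≤ M := by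
  -- per word
  have hb : ∀ v : List ι, ∃ M : ℝ, 0 ≤ M ∧ ∀ p ∈ D.tterms v, ∀ x, |p.1 x| ≤ M := by
    intro v
    have hp : ∀ p ∈ D.tterms v, ∃ M : ℝ, ∀ x, |p.1 x| ≤ M := by
      intro p hp
      obtain ⟨hp1, hp2, _⟩ := D.tterms_spec v p hp
      have hc : HasCompactSupport p.1 :=
        D.hasCompactSupport_m.of_isClosed_subset (isClosed_tsupport _) hp2
      obtain ⟨M, hM⟩ := hp1.continuous.bounded_above_of_compact_support hc
      exact ⟨M, fun x => by simpa [Real.norm_eq_abs] using hM x⟩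
    choose! M hM using hp
    refine ⟨((D.tterms v).map fun p => max (M p) 0).sum,
      List.sum_nonneg fun y hy => ?_, fun p hp x => (hM p hp x).trans ?_⟩
    · obtain ⟨q, _, rfl⟩ := List.mem_map.1 hy; exact le_max_right _ _
    · refine (le_max_left _ 0).trans (le_sum_of_mem_of_nonneg (fun y hy => ?_) ?_)
      · obtain ⟨q, _, rfl⟩ := List.mem_map.1 hy; exact le_max_right _ _
      · exact List.mem_map.2 ⟨p, hp, rfl⟩
  choose M hM0 hM using hb
  have hfin : Set.Finite {v : List ι | v.length ≤ n} := List.finite_length_le ι n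
  obtain ⟨B, hB⟩ := (hfin.image M).bddAbove
  refine ⟨max B 0, le_max_right _ _, fun v hv p hp x => (hM v p hp x).trans ?_⟩
  exact (hB ⟨v, hv, rfl⟩).trans (le_max_left _ _)

omit [DecidableEq ι] in
/-- The number of chain-rule terms: `(1 + card ι)^{|v|}`. [folklore] -/
theorem length_tterms (v : List ι) : (D.tterms v).length = (1 + Fintype.card ι) ^ v.length := by
  induction v with
  | nil => rfl
  | cons i v ih =>
    simp only [tterms, List.length_flatMap, List.length_cons, pow_succ]
    have h : ∀ p : (EuclideanSpace ℝ ι → ℝ) × List ι, (D.tstep i p).length = 1 + Fintype.card ι := by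
      intro p
      simp [tstep, Finset.length_toList, add_comm]
    simp only [h, List.map_const', List.sum_replicate, smul_eq_mul, ih]

/-! ### Change of variables and the `L²` bound -/

omit [DecidableEq ι] in
/-- The Jacobian determinant of `τ` is bounded away from zero on the compact `tsupport m`.
[folklore] -/
theorem exists_det_lower_bound :
    ∃ δ : ℝ, 0 < δ ∧ ∀ x ∈ tsupport D.m, δ ≤ |(fderiv ℝ D.τ x).det| := by
  have hK : IsCompact (tsupport D.m) := D.hasCompactSupport_m
  have hcont : ContinuousOn (fun x => |(fderiv ℝ D.τ x).det|) D.Ω := by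
    have h1 : ContinuousOn (fderiv ℝ D.τ) D.Ω :=
      D.contDiffOn_τ.continuousOn_fderiv_of_isOpen D.isOpen_Ω (by norm_cast)
    exact (continuous_abs.comp ContinuousLinearMap.continuous_det).comp_continuousOn h1
  rcases (tsupport D.m).eq_empty_or_nonempty with h0 | hne
  · exact ⟨1, one_pos, fun x hx => by rw [h0] at hx; exact absurd hx (notMem_empty x)⟩
  · obtain ⟨x₀, hx₀, hmin⟩ := hK.exists_isMinOn hne (hcont.mono D.tsupport_m_subset)
    refine ⟨|(fderiv ℝ D.τ x₀).det|, abs_pos.2 (D.det_ne_zero x₀ (D.tsupport_m_subset hx₀)),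
      fun x hx => hmin hx⟩

omit [DecidableEq ι] [NormedSpace ℝ F] in
/-- **Change of variables on the support**: `∫_K ‖h(τ x)‖² dx ≤ δ⁻¹ ∫ ‖h‖²` in the `ℝ≥0∞` form,
for `K = tsupport m` and `δ` a lower bound of `|det Dτ|` on `K` (Mathlib's
`lintegral_image_eq_lintegral_abs_det_fderiv_mul`). [cite: Evans2010, App. C.4] -/
theorem lintegral_enorm_sq_comp_le (h : EuclideanSpace ℝ ι → F)
    {δ : ℝ} (hδ : 0 < δ) (hδle : ∀ x ∈ tsupport D.m, δ ≤ |(fderiv ℝ D.τ x).det|) :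
    ∫⁻ x in tsupport D.m, ‖h (D.τ x)‖ₑ ^ 2 ≤ (ENNReal.ofReal δ)⁻¹ * ∫⁻ y, ‖h y‖ₑ ^ 2 := by
  set K := tsupport D.m with hK
  have hKm : MeasurableSet K := (isClosed_tsupport _).measurableSet
  have hderiv : ∀ x ∈ K, HasFDerivWithinAt D.τ (fderiv ℝ D.τ x) K x := fun x hx =>
    ((D.contDiffOn_τ.differentiableOn (by simp)).differentiableAt
      (D.isOpen_Ω.mem_nhds (D.tsupport_m_subset hx))).hasFDerivAt.hasFDerivWithinAt
  have hinj : InjOn D.τ K := D.injOn_τ.mono D.tsupport_m_subset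
  have hcv := lintegral_image_eq_lintegral_abs_det_fderiv_mul volume hKm hderiv hinj
    (fun y => ‖h y‖ₑ ^ 2)
  have h1 : ENNReal.ofReal δ * ∫⁻ x in K, ‖h (D.τ x)‖ₑ ^ 2 ≤ ∫⁻ y, ‖h y‖ₑ ^ 2 := by
    calc ENNReal.ofReal δ * ∫⁻ x in K, ‖h (D.τ x)‖ₑ ^ 2
        = ∫⁻ x in K, ENNReal.ofReal δ * ‖h (D.τ x)‖ₑ ^ 2 := by
          rw [lintegral_const_mul' _ _ ENNReal.ofReal_ne_top]
      _ ≤ ∫⁻ x in K, ENNReal.ofReal |(fderiv ℝ D.τ x).det| * ‖h (D.τ x)‖ₑ ^ 2 := by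
          refine setLIntegral_mono' hKm fun x hx => ?_
          exact mul_le_mul' (ENNReal.ofReal_le_ofReal (hδle x hx)) le_rfl
      _ = ∫⁻ y in D.τ '' K, ‖h y‖ₑ ^ 2 := hcv.symm
      _ ≤ ∫⁻ y, ‖h y‖ₑ ^ 2 := setLIntegral_le_lintegral _ _
  have hδ' : ENNReal.ofReal δ ≠ 0 := by simpa using hδ
  calc ∫⁻ x in K, ‖h (D.τ x)‖ₑ ^ 2
      = (ENNReal.ofReal δ)⁻¹ * (ENNReal.ofReal δ * ∫⁻ x in K, ‖h (D.τ x)‖ₑ ^ 2) := by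
        rw [← mul_assoc, ENNReal.inv_mul_cancel hδ' ENNReal.ofReal_ne_top, one_mul]
    _ ≤ (ENNReal.ofReal δ)⁻¹ * ∫⁻ y, ‖h y‖ₑ ^ 2 := mul_le_mul' le_rfl h1

omit [DecidableEq ι] [NormedSpace ℝ F] in
/-- **`L²` form of the change of variables**, in `ℝ≥0∞`:
`‖𝟙_K (h ∘ τ)‖_{L²} ≤ (δ⁻¹)^{1/2} ‖h‖_{L²}`, `K = tsupport m`. [cite: Evans2010, App. C.4] -/
theorem eLpNorm_indicator_comp_le (h : EuclideanSpace ℝ ι → F)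
    {δ : ℝ} (hδ : 0 < δ) (hδle : ∀ x ∈ tsupport D.m, δ ≤ |(fderiv ℝ D.τ x).det|) :
    eLpNorm ((tsupport D.m).indicator fun x => h (D.τ x)) 2 (volume : Measure (EuclideanSpace ℝ ι)) ≤
      ((ENNReal.ofReal δ)⁻¹) ^ (2 : ℝ)⁻¹ * eLpNorm h 2 (volume : Measure (EuclideanSpace ℝ ι)) := by
  have hKm : MeasurableSet (tsupport D.m) := (isClosed_tsupport _).measurableSet
  rw [eLpNorm_indicator_eq_eLpNorm_restrict hKm,
    eLpNorm_eq_lintegral_rpow_enorm_toReal (by norm_num) (by norm_num),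
    eLpNorm_eq_lintegral_rpow_enorm_toReal (by norm_num) (by norm_num)]
  norm_num
  rw [← ENNReal.mul_rpow_of_nonneg _ _ (by norm_num)]
  refine ENNReal.rpow_le_rpow ?_ (by norm_num)
  have h1 := D.lintegral_enorm_sq_comp_le h hδ hδle
  simpa using h1

omit [DecidableEq ι] [NormedSpace ℝ F] in
/-- **`L²` form of the change of variables**, real: `l2On K (h ∘ τ) ≤ (δ^{1/2})⁻¹ ‖h‖_{L²}` for
`h ∈ L²`, `K = tsupport m`. [cite: Evans2010, App. C.4] -/
theorem l2On_comp_le {h : EuclideanSpace ℝ ι → F}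
    (hh2 : MemLp h 2 (volume : Measure (EuclideanSpace ℝ ι)))
    {δ : ℝ} (hδ : 0 < δ) (hδle : ∀ x ∈ tsupport D.m, δ ≤ |(fderiv ℝ D.τ x).det|) :
    l2On (tsupport D.m) (fun x => h (D.τ x)) ≤
      (δ ^ (2 : ℝ)⁻¹)⁻¹ * (eLpNorm h 2 (volume : Measure (EuclideanSpace ℝ ι))).toReal := by
  have h2 := D.eLpNorm_indicator_comp_le h hδ hδle
  have hfin : ((ENNReal.ofReal δ)⁻¹) ^ (2 : ℝ)⁻¹ * eLpNorm h 2 (volume : Measure (EuclideanSpace ℝ ι)) ≠ ⊤ := by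
    refine ENNReal.mul_ne_top ?_ hh2.eLpNorm_ne_top
    refine (ENNReal.rpow_lt_top_of_nonneg (by norm_num) ?_).ne
    exact ENNReal.inv_ne_top.2 (by simpa using hδ)
  rw [l2On_def]
  refine (ENNReal.toReal_mono hfin h2).trans_eq ?_
  rw [ENNReal.toReal_mul]
  congr 1
  rw [← ENNReal.toReal_rpow, ENNReal.toReal_inv, ENNReal.toReal_ofReal hδ.le,
    Real.inv_rpow hδ.le]

omit [DecidableEq ι] [NormedSpace ℝ F] in
/-- Pointwise domination in `l2On` with a finiteness (instead of continuity) hypothesis on the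
dominating function. [folklore] -/
theorem l2On_le_mul_of_le' {K : Set (EuclideanSpace ℝ ι)} {G : Type*} [NormedAddCommGroup G]
    {f : EuclideanSpace ℝ ι → F} {g : EuclideanSpace ℝ ι → G}
    (hg : eLpNorm (K.indicator g) 2 (volume : Measure (EuclideanSpace ℝ ι)) ≠ ⊤) {c : ℝ} (hc : 0 ≤ c)
    (h : ∀ x ∈ K, ‖f x‖ ≤ c * ‖g x‖) : l2On K f ≤ c * l2On K g := by
  rw [l2On_def, l2On_def]
  have hpt : ∀ x, ‖K.indicator f x‖ ≤ c * ‖K.indicator g x‖ := fun x => by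
    by_cases hx : x ∈ K
    · rw [indicator_of_mem hx, indicator_of_mem hx]; exact h x hx
    · rw [indicator_of_notMem hx, indicator_of_notMem hx]; simp
  have h1 := eLpNorm_le_mul_eLpNorm_of_ae_le_mul (p := (2 : ℝ≥0∞))
    (μ := (volume : Measure (EuclideanSpace ℝ ι))) (Eventually.of_forall hpt)
  calc (eLpNorm (K.indicator f) 2 volume).toReal
      ≤ (ENNReal.ofReal c * eLpNorm (K.indicator g) 2 volume).toReal :=
        ENNReal.toReal_mono (ENNReal.mul_ne_top ENNReal.ofReal_ne_top hg) h1
    _ = c * (eLpNorm (K.indicator g) 2 volume).toReal := by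
        rw [ENNReal.toReal_mul, ENNReal.toReal_ofReal hc]

omit [DecidableEq ι] in
/-- **The `L²` bound for derivatives of the transfer**: for every order `n` there is `C ≥ 0`
(depending on `m, τ, n` only) such that for every smooth compactly supported `u`, every word
`|v| ≤ n` and every `Y ≥ 0` bounding `‖∂_w u‖_{L²}` for all `|w| ≤ n`:
`‖∂_v (m · u ∘ τ)‖_{L²} ≤ C Y`. [cite: Adams1975, Thm. 3.35] -/
theorem exists_l2_cwd_transfer_le (n : ℕ) :
    ∃ C : ℝ, 0 ≤ C ∧ ∀ u : EuclideanSpace ℝ ι → F, ContDiff ℝ ∞ u → HasCompactSupport u →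
      ∀ v : List ι, v.length ≤ n → ∀ Y : ℝ, 0 ≤ Y →
        (∀ w : List ι, w.length ≤ n →
          (eLpNorm (cwd w u) 2 (volume : Measure (EuclideanSpace ℝ ι))).toReal ≤ Y) →
        (eLpNorm (cwd v (transfer D.m D.τ u)) 2 (volume : Measure (EuclideanSpace ℝ ι))).toReal ≤
          C * Y := by
  obtain ⟨M, hM0, hM⟩ := D.exists_coef_bound n
  obtain ⟨δ, hδ, hδle⟩ := D.exists_det_lower_bound
  set K := tsupport D.m with hK
  have hKc : IsCompact K := D.hasCompactSupport_m
  set A : ℝ := (δ ^ (2 : ℝ)⁻¹)⁻¹ with hA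
  have hA0 : 0 ≤ A := by rw [hA]; positivity
  refine ⟨(1 + Fintype.card ι) ^ n * (M * A), by positivity, ?_⟩
  intro u hu huc v hv Y hY hYb
  -- the derivative is supported in `K`, so its `L²` norm is `l2On K`
  have hsupp : tsupport (cwd v (transfer D.m D.τ u)) ⊆ K :=
    (tsupport_cwd_subset v _).trans (D.tsupport_transfer_subset u)
  have hind : K.indicator (cwd v (transfer D.m D.τ u)) = cwd v (transfer D.m D.τ u) := by
    funext x
    by_cases hx : x ∈ K
    · rw [indicator_of_mem hx]
    · rw [indicator_of_notMem hx, image_eq_zero_of_notMem_tsupport fun h => hx (hsupp h)]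
  have heq : (eLpNorm (cwd v (transfer D.m D.τ u)) 2 (volume : Measure (EuclideanSpace ℝ ι))).toReal
      = l2On K (cwd v (transfer D.m D.τ u)) := by rw [l2On_def, hind]
  rw [heq, D.cwd_transfer hu v]
  -- term by term
  have hterm : ∀ p ∈ D.tterms v, l2On K (fun x => p.1 x • cwd p.2 u (D.τ x)) ≤ M * A * Y := by
    intro p hp
    obtain ⟨_, _, hp3⟩ := D.tterms_spec v p hp
    have hw : p.2.length ≤ n := hp3.trans hv
    have hmem : MemLp (cwd p.2 u) 2 (volume : Measure (EuclideanSpace ℝ ι)) :=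
      (continuous_cwd hu p.2).memLp_of_hasCompactSupport (hasCompactSupport_cwd huc p.2)
    have hcomp := D.l2On_comp_le hmem hδ hδle
    have hfin : eLpNorm (K.indicator fun x => cwd p.2 u (D.τ x)) 2
        (volume : Measure (EuclideanSpace ℝ ι)) ≠ ⊤ := by
      refine ne_top_of_le_ne_top ?_ (D.eLpNorm_indicator_comp_le (cwd p.2 u) hδ hδle)
      refine ENNReal.mul_ne_top ?_ hmem.eLpNorm_ne_top
      refine (ENNReal.rpow_lt_top_of_nonneg (by norm_num) ?_).ne
      exact ENNReal.inv_ne_top.2 (by simpa using hδ)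
    calc l2On K (fun x => p.1 x • cwd p.2 u (D.τ x))
        ≤ M * l2On K (fun x => cwd p.2 u (D.τ x)) := by
          refine l2On_le_mul_of_le' hfin hM0 fun x _ => ?_
          rw [norm_smul, Real.norm_eq_abs]
          exact mul_le_mul_of_nonneg_right (hM v hv p hp x) (norm_nonneg _)
      _ ≤ M * (A * Y) := by
          refine mul_le_mul_of_nonneg_left (hcomp.trans ?_) hM0
          exact mul_le_mul_of_nonneg_left (hYb p.2 hw) hA0
      _ = M * A * Y := by ring
  -- sum
  have hcont : ∀ p ∈ D.tterms v, Continuous fun x => p.1 x • cwd p.2 u (D.τ x) := by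
    intro p hp
    obtain ⟨hp1, hp2, _⟩ := D.tterms_spec v p hp
    exact (contDiff_cutoff_smul D.isOpen_Ω hp1 (hp2.trans D.tsupport_m_subset)
      ((contDiff_cwd hu p.2).comp_contDiffOn D.contDiffOn_τ)).1.continuous
  refine (l2On_list_sum_le hKc (D.tterms v) hcont).trans ?_
  calc ((D.tterms v).map fun p => l2On K fun x => p.1 x • cwd p.2 u (D.τ x)).sum
      ≤ ((D.tterms v).map fun _ => M * A * Y).sum := List.sum_le_sum fun p hp => hterm p hp
    _ = (D.tterms v).length * (M * A * Y) := by
        rw [List.map_const', List.sum_replicate, nsmul_eq_mul]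
    _ ≤ (1 + Fintype.card ι) ^ n * (M * A * Y) := by
        refine mul_le_mul_of_nonneg_right ?_ (by positivity)
        rw [D.length_tterms]
        exact_mod_cast Nat.pow_le_pow_right (by omega) hv
    _ = (1 + Fintype.card ι) ^ n * (M * A) * Y := by ring

omit [DecidableEq ι] in
/-- **The sup bound for derivatives of the transfer**: with `C = (1 + card ι)^n M`,
`‖∂_v (m · u ∘ τ)(x)‖ ≤ C R` whenever `‖∂_w u‖ ≤ R` on `τ(tsupport m)` for all `|w| ≤ n`.
[cite: Adams1975, Thm. 3.35] -/
theorem exists_sup_cwd_transfer_le (n : ℕ) :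
    ∃ C : ℝ, 0 ≤ C ∧ ∀ u : EuclideanSpace ℝ ι → F, ContDiff ℝ ∞ u →
      ∀ v : List ι, v.length ≤ n → ∀ R : ℝ, 0 ≤ R →
        (∀ w : List ι, w.length ≤ n → ∀ y ∈ D.τ '' tsupport D.m, ‖cwd w u y‖ ≤ R) →
        ∀ x, ‖cwd v (transfer D.m D.τ u) x‖ ≤ C * R := by
  obtain ⟨M, hM0, hM⟩ := D.exists_coef_bound n
  refine ⟨(1 + Fintype.card ι) ^ n * M, by positivity, ?_⟩
  intro u hu v hv R hR hRb x
  by_cases hx : x ∈ tsupport D.m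
  · refine (D.norm_cwd_transfer_le hu v x).trans ?_
    calc ((D.tterms v).map fun p => |p.1 x| * ‖cwd p.2 u (D.τ x)‖).sum
        ≤ ((D.tterms v).map fun _ => M * R).sum := by
          refine List.sum_le_sum fun p hp => ?_
          obtain ⟨_, _, hp3⟩ := D.tterms_spec v p hp
          exact mul_le_mul (hM v hv p hp x) (hRb p.2 (hp3.trans hv) _ ⟨x, hx, rfl⟩)
            (norm_nonneg _) hM0
      _ = (D.tterms v).length * (M * R) := by
          rw [List.map_const', List.sum_replicate, nsmul_eq_mul]
      _ ≤ (1 + Fintype.card ι) ^ n * (M * R) := by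
          refine mul_le_mul_of_nonneg_right ?_ (by positivity)
          rw [D.length_tterms]
          exact_mod_cast Nat.pow_le_pow_right (by omega) hv
      _ = (1 + Fintype.card ι) ^ n * M * R := by ring
  · have h0 : cwd v (transfer D.m D.τ u) x = 0 :=
      image_eq_zero_of_notMem_tsupport fun h =>
        hx ((tsupport_cwd_subset v _).trans (D.tsupport_transfer_subset u) h)
    rw [h0, norm_zero]
    positivity

end TransferData

end Literature.Analysis.PDE

end
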